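import Literature.NumberTheory.Automorphic.LocalHermitianFormsRankThree
import Literature.NumberTheory.Automorphic.LocalUnitaryGroupCongr
import HarnessLib

/-!
# Stub S2 `stub_T1g_locallyQuasiSplit` of the ENGINE T1 line `F0_T1InnerFormTraceIdentity` (crux H413): CLOSED

Cell `hodgecm-mathlib`, floor 0, sub-programme P3a (ENGINE T1 = [Rogawski1990] Thm 14.6.1 trace identity for the inner
form `G′ = U(H)` of `U(3)`).  This file closes the registered stub **S2** (`StubT1gLocallyQuasiSplit L H`, T1g: the
bottom layer `S = ∅` of the local transfer, [Rogawski1990, §14.2 p. 232 (i)–(iii)]): for a CM field `L`, an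
anisotropic hermitian `H ∈ M₃(L)` and EVERY finite place `v` of `L⁺`, the local groups `U(H)(L⁺_v)` and `U(Φ₃)(L⁺_v)`
of the tree's data `UnitaryGroup.cmDatum L 3 H` and `UnitaryGroup.cmDatum L 3 Φ₃` (`Φ₃ = antidiag(1,1,1)`, the
quasi-split form) are isomorphic topological groups.

The TYPE of `stubT1gLocallyQuasiSplit_holds` is the body of the line's `StubT1gLocallyQuasiSplit L H` VERBATIM over
tree tokens (s347 closer protocol: Theorems never import `Cruxes/…/Lines`; the registrar folds
`theorem stub_T1g_locallyQuasiSplit : StubT1gLocallyQuasiSplit L H := stubT1gLocallyQuasiSplit_holds L H`).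

Proof = the tree's reduction ★ `UnitaryGroup.nonempty_cmDatum_local_equiv_antidiag_of_forall_nonsplit_formCongr`
(`LocalUnitaryGroupCongr.lean`, B3: split places via ★ `localSplitEquiv`, transport of a local similitude) fed with the
non-split input ★ `UnitaryGroup.exists_isUnit_formCongr_map_eq_smul_antidiag_of_smul_eq`
(`LocalHermitianFormsRankThree.lean`, B4: over the field `L ⊗ L⁺_v` every rank-3 hermitian form is `a • Φ₃` in a suitable
frame — Witt completion of a hyperbolic pair, isotropy from `u(L⁺_v) = 4`).  The anisotropy hypothesis enters through
`det H ≠ 0` (★ `Godement.det_ne_zero_of_anisotropic`); the hermitian hypothesis is used as stated.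

HONEST LABEL: HC_CM is proved only modulo the printed citations until rung 0 closes; this file is unconditional
(axioms ⊆ {propext, Classical.choice, Quot.sound}) and closes one stub of one line; T1 as a whole is a programme.
-/

set_option autoImplicit false
-- the cell's namespace `Summit.HodgeConjecture.HodgeConjecture.…` (summit = problem) repeats a component by design
set_option linter.dupNamespace false

noncomputable section

namespace Summit.HodgeConjecture.HodgeConjecture.Cruxes.H413.F0P3aStubS2LocallyQuasiSplit

open MeasureTheory Measure NumberField IsDedekindDomain
open Literature.NumberTheory.Automorphic
open Literature.AlgebraicGeometry.ShimuraVarieties (hermForm)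

variable (L : Type) [Field L] [NumberField L] [IsCMField L]

/-- **Stub S2 (T1g) of the line `F0_T1InnerFormTraceIdentity`, CLOSED** — [Rogawski1990, §14.2 p. 232 (i)–(iii)] for
the matrix-algebra inner form `D = M₃(L)`: for `H ∈ M₃(L)` anisotropic and hermitian and every finite place `v` of
`L⁺`, `U(H)(L⁺_v) ≃ₜ* U(Φ₃)(L⁺_v)`.  TYPE = body of `StubT1gLocallyQuasiSplit L H` verbatim.
[cite: Rogawski1990, §14.2 p. 232] -/
theorem stubT1gLocallyQuasiSplit_holds (H : Matrix (Fin 3) (Fin 3) L) :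
    (∀ x : Fin 3 → L, hermForm (cmConjRingHom L) H x x = 0 → x = 0) → (H.map (cmConjRingHom L)).transpose = H →
    ∀ v : HeightOneSpectrum (𝓞 ↥(maximalRealSubfield L)),
      Nonempty ((UnitaryGroup.cmDatum L 3 H).Local v ≃ₜ*
        (UnitaryGroup.cmDatum L 3 (Matrix.of fun i j : Fin 3 => if i.val + j.val + 1 = 3 then (1 : L) else 0)).Local v) := by
  intro hanis hherm
  exact UnitaryGroup.nonempty_cmDatum_local_equiv_antidiag_of_forall_nonsplit_formCongr L H hanis hherm
    fun v w hw => UnitaryGroup.exists_isUnit_formCongr_map_eq_smul_antidiag_of_smul_eq L (IsCMField.complexConj L)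
      (IsCMField.complexConj_ne_one L) H hherm (Godement.det_ne_zero_of_anisotropic L H hanis) w hw

end Summit.HodgeConjecture.HodgeConjecture.Cruxes.H413.F0P3aStubS2LocallyQuasiSplit

end
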